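import Literature.NumberTheory.Sieve.FGKMT2018Theorem6Decomposition
import Literature.NumberTheory.Sieve.BombieriVinogradovCoprime
import Literature.NumberTheory.Sieve.LevelOfDistributionProofs
import HarnessLib

/-!
# FGKMT 2018, Lemma 7.2 — proof

K. Ford, B. Green, S. Konyagin, J. Maynard, T. Tao, *Long gaps between primes*,
J. Amer. Math. Soc. 31 (2018), Lemma 7.2 (`[FordGreenKonyaginMaynardTao2018]`, §7,
pp. 20–22 of arXiv:1412.5029): the Landau–Page theorem supplies a modulus `B`
(`= 1` or prime) such that, after discarding the moduli divisible by `B`, the primes have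
level of distribution `x^{9/20}` with a saving `exp(-c √log x)` (`bombieriVinogradov_coprime`,
the ψ-form of display (7.5)); this beats the loss `(log y)^{100 k²}` demanded by
Hypothesis 1 of the multidimensional sieve (`HypothesisOneZ`) as soon as
`k ≤ (log x)^{1/5}`.  We assemble this into
`theorem fordGreenKonyaginMaynardTao2018_lemma72_holds : FordGreenKonyaginMaynardTao2018_lemma72`
(with `C_H = 1`).

Bookkeeping (all elementary): the set `{n ∈ (y, 2y] : a n + b prime, n ≡ c (q)}` is, via
`n ↦ a n + b`, the set of primes in an interval `[V_lo, V_hi] ⊆ [0, 4 x log³ x]` lying in the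
residue class `a c + b (mod |a| q)`; counting functions of primes in progressions on an interval
are differences of two values of `primeCountingDisc`, which is controlled by `ψ` through the
partial-summation lemmas of `LevelOfDistributionProofs`.
-/

namespace Literature.NumberTheory.Sieve

open Finset Real Filter
open scoped BigOperators

namespace FGKMT2018

/-! ### From `bombieriVinogradov_coprime` to a pointwise majorant `A m` -/

/-- Max-form of the `B`-coprime Bombieri–Vinogradov theorem: for every modulus `m` there is a
bound `A m ≥ 0` for `|ψ(n; m, a) - n/φ(m)|`, uniformly in reduced `a` and integers `n ≤ X`,
with `∑_{m ≤ Q, (m,B)=1} A m ≤ K X exp(-c √log X)`.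
[cite: FordGreenKonyaginMaynardTao2018, §7 (7.5)] -/
theorem bvMax_of_bv {c K : ℝ}
    (hBV : ∀ᶠ X : ℝ in atTop, ∃ B : ℕ, (B = 1 ∨ B.Prime) ∧
        (B : ℝ) ≤ Real.exp (Real.sqrt (Real.log X)) ∧
        ∀ Q : ℕ, (Q : ℝ) ≤ X ^ (9 / 20 : ℝ) → ∀ y : ℕ → ℝ, (∀ q, 0 ≤ y q ∧ y q ≤ X) →
          ∑ q ∈ (Icc 1 Q).filter (fun q => Nat.Coprime q B),
              ⨆ a : (ZMod q)ˣ, |ParityWave0.chebyshevPsiMod q a (y q) - y q / Nat.totient q| ≤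
            K * X * Real.exp (-(c * Real.sqrt (Real.log X)))) :
    ∀ᶠ X : ℝ in atTop, ∃ B : ℕ, (B = 1 ∨ B.Prime) ∧
      (B : ℝ) ≤ Real.exp (Real.sqrt (Real.log X)) ∧
      ∀ Q : ℕ, (Q : ℝ) ≤ X ^ (9 / 20 : ℝ) → ∃ A : ℕ → ℝ, (∀ m, 0 ≤ A m) ∧
        (∀ (m : ℕ), m ≠ 0 → ∀ (a : (ZMod m)ˣ) (n : ℕ), (n : ℝ) ≤ X →
            |ParityWave0.chebyshevPsiMod m a n - n / Nat.totient m| ≤ A m) ∧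
        ∑ m ∈ (Icc 1 Q).filter (fun m => Nat.Coprime m B), A m ≤
          K * X * Real.exp (-(c * Real.sqrt (Real.log X))) := by
  filter_upwards [hBV, eventually_ge_atTop 0] with X hX hX0
  obtain ⟨B, hB, hBle, hsum⟩ := hX
  refine ⟨B, hB, hBle, fun Q hQ => ?_⟩
  set F : ℕ → ℕ → ℝ := fun m n =>
    ⨆ a : (ZMod m)ˣ, |ParityWave0.chebyshevPsiMod m a n - n / Nat.totient m| with hF
  have hne : (Finset.range (⌊X⌋₊ + 1)).Nonempty := ⟨0, by simp⟩
  choose nm hnm hmax using fun m => Finset.exists_max_image (range (⌊X⌋₊ + 1)) (F m) hne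
  refine ⟨fun m => F m (nm m), fun m => ?_, fun m hm a n hn => ?_, ?_⟩
  · exact Real.iSup_nonneg fun a => abs_nonneg _
  · haveI : NeZero m := ⟨hm⟩
    have hbdd : BddAbove (Set.range fun a : (ZMod m)ˣ =>
        |ParityWave0.chebyshevPsiMod m a n - n / Nat.totient m|) :=
      (Set.finite_range _).bddAbove
    have h1 : |ParityWave0.chebyshevPsiMod m a n - n / Nat.totient m| ≤ F m n :=
      le_ciSup hbdd a
    have h2 : F m n ≤ F m (nm m) :=
      hmax m n (Finset.mem_range.2 (Nat.lt_succ_of_le (Nat.le_floor hn)))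
    exact h1.trans h2
  · have hy : ∀ m, 0 ≤ ((nm m : ℕ) : ℝ) ∧ ((nm m : ℕ) : ℝ) ≤ X := by
      intro m
      refine ⟨Nat.cast_nonneg _, ?_⟩
      have h1 : nm m ≤ ⌊X⌋₊ := Nat.le_of_lt_succ (Finset.mem_range.1 (hnm m))
      exact (Nat.cast_le.2 h1).trans (Nat.floor_le hX0)
    have := hsum Q hQ (fun m => ((nm m : ℕ) : ℝ)) hy
    simpa only [hF] using this

/-! ### The analytic comparison `(log y)^{100k²} ≪ exp(c √log x)` -/

/-- `log L ≤ L/20 + 2` for `L > 0` (from `log u ≤ u - 1` at `u = L/20`). [folklore] -/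
private theorem log_le_div_twenty_add_two {L : ℝ} (hL : 0 < L) : Real.log L ≤ L / 20 + 2 := by
  have h1 := Real.log_le_sub_one_of_pos (show 0 < L / 20 by linarith)
  rw [Real.log_div hL.ne' (by norm_num)] at h1
  have h2 : Real.log 20 < 3 := by
    rw [Real.log_lt_iff_lt_exp (by norm_num)]
    have h3 : (2.7182818283 : ℝ) ^ 3 < Real.exp 1 ^ 3 :=
      pow_lt_pow_left₀ Real.exp_one_gt_d9 (by norm_num) (by norm_num)
    rw [Real.exp_one_pow] at h3
    push_cast at h3
    linarith [show (20 : ℝ) < 2.7182818283 ^ 3 by norm_num]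
  linarith

/-- Eventually in `x`, uniformly for `k ≤ (log x)^{1/5}`:
`(100 k² + 9) log(2 log x) + C₀ ≤ (c/2) √log x` (the comparison `(log y)^{100k²} = x^{o(1)}`
against the saving `exp(-c√log x)`). [cite: FordGreenKonyaginMaynardTao2018, §7 proof of Lemma 7.2] -/
private theorem eventually_klog_le (C₀ : ℝ) {c : ℝ} (hc : 0 < c) :
    ∀ᶠ x : ℕ in atTop, ∀ k : ℕ, (k : ℝ) ≤ Real.log x ^ ((1 : ℝ) / 5) →
      (100 * (k : ℝ) ^ 2 + 9) * Real.log (2 * Real.log x) + C₀ ≤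
        c / 2 * Real.sqrt (Real.log x) := by
  have hw : Tendsto (fun x : ℕ => Real.log (x : ℝ) ^ ((1 : ℝ) / 10)) atTop atTop :=
    (tendsto_rpow_atTop (by norm_num)).comp
      (Real.tendsto_log_atTop.comp tendsto_natCast_atTop_atTop)
  have h1 : ∀ᶠ w : ℝ in atTop, Real.log w ≤ c / 4360 * w := by
    have := Real.isLittleO_log_id_atTop.bound (show (0 : ℝ) < c / 4360 by positivity)
    filter_upwards [this, eventually_ge_atTop 1] with w hw hw1
    rw [Real.norm_of_nonneg (Real.log_nonneg hw1), id,
      Real.norm_of_nonneg (by linarith)] at hw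
    exact hw
  filter_upwards [hw.eventually h1, hw.eventually (eventually_ge_atTop (1 : ℝ)),
    hw.eventually (eventually_ge_atTop (4 * (109 + |C₀|) / c)),
    eventually_gt_atTop 1] with x hlog hw1 hwC hx1
  intro k hk
  have hx1' : (1 : ℝ) < x := by exact_mod_cast hx1
  have hL0 : 0 < Real.log x := Real.log_pos hx1'
  set L := Real.log (x : ℝ) with hLdef
  set w := L ^ ((1 : ℝ) / 10) with hwdef
  have hLw : L = w ^ 10 := by
    rw [hwdef, ← Real.rpow_natCast, ← Real.rpow_mul hL0.le]; norm_num
  have h15 : L ^ ((1 : ℝ) / 5) = w ^ 2 := by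
    rw [hwdef, ← Real.rpow_natCast, ← Real.rpow_mul hL0.le]; norm_num
  have hsqrt : Real.sqrt L = w ^ 5 := by
    rw [Real.sqrt_eq_rpow, hwdef, ← Real.rpow_natCast, ← Real.rpow_mul hL0.le]; norm_num
  have hk2 : (k : ℝ) ^ 2 ≤ w ^ 4 := by
    rw [h15] at hk
    calc (k : ℝ) ^ 2 ≤ (w ^ 2) ^ 2 := pow_le_pow_left₀ (Nat.cast_nonneg k) hk 2
      _ = w ^ 4 := by ring
  have hlog2L : Real.log (2 * L) = Real.log 2 + 10 * Real.log w := by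
    rw [Real.log_mul two_ne_zero hL0.ne', hLw, Real.log_pow]; push_cast; ring
  have hlw0 : 0 ≤ Real.log w := Real.log_nonneg hw1
  have hl2 : Real.log 2 ≤ 1 := by have := Real.log_two_lt_d9; linarith
  have hw4 : 1 ≤ w ^ 4 := one_le_pow₀ hw1
  have hl20 : 0 ≤ Real.log 2 := by have := Real.log_two_gt_d9; linarith
  rw [hlog2L, hsqrt]
  have e1 : (100 * (k : ℝ) ^ 2 + 9) * (Real.log 2 + 10 * Real.log w) ≤
      109 * w ^ 4 * (1 + 10 * Real.log w) := by
    have : 100 * (k : ℝ) ^ 2 + 9 ≤ 109 * w ^ 4 := by linarith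
    exact mul_le_mul this (by linarith) (by linarith) (by positivity)
  have e2 : C₀ ≤ |C₀| * w ^ 4 :=
    (le_abs_self C₀).trans (le_mul_of_one_le_right (abs_nonneg _) hw4)
  have e3 : 109 * (1 + 10 * Real.log w) + |C₀| ≤ c / 2 * w := by
    have h := hwC
    rw [div_le_iff₀ hc] at h
    linarith
  calc (100 * (k : ℝ) ^ 2 + 9) * (Real.log 2 + 10 * Real.log w) + C₀
      ≤ 109 * w ^ 4 * (1 + 10 * Real.log w) + |C₀| * w ^ 4 := add_le_add e1 e2
    _ = w ^ 4 * (109 * (1 + 10 * Real.log w) + |C₀|) := by ring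
    _ ≤ w ^ 4 * (c / 2 * w) := mul_le_mul_of_nonneg_left e3 (by positivity)
    _ = c / 2 * w ^ 5 := by ring

/-! ### The affine change of variables `n ↦ a n + b` -/

/-- The values of the form on the dyadic block lie between its values at the endpoints.
[folklore] -/
private theorem formEval_mem_Icc {l : ℤ × ℤ} {y : ℝ} {n : ℤ} (hn : n ∈ dyadZ y) :
    min (formEval l ⌈y⌉) (formEval l ⌊2 * y⌋) ≤ formEval l n ∧
      formEval l n ≤ max (formEval l ⌈y⌉) (formEval l ⌊2 * y⌋) := by
  rw [dyadZ, Finset.mem_Icc] at hn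
  simp only [formEval]
  rcases le_or_gt 0 l.1 with ha | ha
  · have h1 : l.1 * ⌈y⌉ ≤ l.1 * n := mul_le_mul_of_nonneg_left hn.1 ha
    have h2 : l.1 * n ≤ l.1 * ⌊2 * y⌋ := mul_le_mul_of_nonneg_left hn.2 ha
    exact ⟨(min_le_left _ _).trans (by linarith), le_trans (by linarith) (le_max_right _ _)⟩
  · have h1 : l.1 * ⌊2 * y⌋ ≤ l.1 * n := mul_le_mul_of_nonpos_left hn.2 ha.le
    have h2 : l.1 * n ≤ l.1 * ⌈y⌉ := mul_le_mul_of_nonpos_left hn.1 ha.le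
    exact ⟨(min_le_right _ _).trans (by linarith), le_trans (by linarith) (le_max_left _ _)⟩

/-- Converse: an integer `n` with `a n + b` between the endpoint values lies in the block.
[folklore] -/
private theorem mem_dyadZ_of_formEval {l : ℤ × ℤ} (ha : l.1 ≠ 0) {y : ℝ} (hne : ⌈y⌉ ≤ ⌊2 * y⌋)
    {n : ℤ} (h1 : min (formEval l ⌈y⌉) (formEval l ⌊2 * y⌋) ≤ formEval l n)
    (h2 : formEval l n ≤ max (formEval l ⌈y⌉) (formEval l ⌊2 * y⌋)) : n ∈ dyadZ y := by
  rw [dyadZ, Finset.mem_Icc]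
  simp only [formEval] at h1 h2
  rcases lt_or_gt_of_ne ha with ha | ha
  · have hmin : min (l.1 * ⌈y⌉ + l.2) (l.1 * ⌊2 * y⌋ + l.2) = l.1 * ⌊2 * y⌋ + l.2 :=
      min_eq_right (by nlinarith [mul_le_mul_of_nonpos_left hne ha.le])
    have hmax : max (l.1 * ⌈y⌉ + l.2) (l.1 * ⌊2 * y⌋ + l.2) = l.1 * ⌈y⌉ + l.2 :=
      max_eq_left (by nlinarith [mul_le_mul_of_nonpos_left hne ha.le])
    rw [hmin] at h1
    rw [hmax] at h2
    constructor
    · refine le_of_not_gt fun hc => ?_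
      have := mul_lt_mul_of_neg_left hc ha
      linarith
    · refine le_of_not_gt fun hc => ?_
      have := mul_lt_mul_of_neg_left hc ha
      linarith
  · have hmin : min (l.1 * ⌈y⌉ + l.2) (l.1 * ⌊2 * y⌋ + l.2) = l.1 * ⌈y⌉ + l.2 :=
      min_eq_left (by nlinarith [mul_le_mul_of_nonneg_left hne ha.le])
    have hmax : max (l.1 * ⌈y⌉ + l.2) (l.1 * ⌊2 * y⌋ + l.2) = l.1 * ⌊2 * y⌋ + l.2 :=
      max_eq_right (by nlinarith [mul_le_mul_of_nonneg_left hne ha.le])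
    rw [hmin] at h1
    rw [hmax] at h2
    constructor
    · refine le_of_not_gt fun hc => ?_
      have := mul_lt_mul_of_pos_left hc ha
      linarith
    · refine le_of_not_gt fun hc => ?_
      have := mul_lt_mul_of_pos_left hc ha
      linarith

/-- **Change of variables.**  For a non-degenerate form `a n + b`, non-negative on the
(non-empty) block `(y, 2y]`, the count `primeCountZMod l y q c` equals the number of primes
`p ∈ [V_lo, V_hi]` with `p ≡ a c + b (mod |a| q)`, where `V_lo ≤ V_hi` are the values of the
form at the two endpoints of the block.
[cite: FordGreenKonyaginMaynardTao2018, §7 proof of Lemma 7.2] -/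
theorem primeCountZMod_eq_card {l : ℤ × ℤ} (ha : l.1 ≠ 0) {y : ℝ} (hne : ⌈y⌉ ≤ ⌊2 * y⌋)
    (hpos : ∀ n ∈ dyadZ y, 0 ≤ formEval l n) {q : ℕ} (c : ℤ) {M : ℕ}
    (hM : M = l.1.natAbs * q) :
    primeCountZMod l y q c =
      #((Finset.Icc (min (formEval l ⌈y⌉) (formEval l ⌊2 * y⌋)).toNat
          (max (formEval l ⌈y⌉) (formEval l ⌊2 * y⌋)).toNat).filter
        (fun p : ℕ => p.Prime ∧ (p : ZMod M) = ((formEval l c : ℤ) : ZMod M))) := by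
  have hmem1 : ⌈y⌉ ∈ dyadZ y := by rw [dyadZ, Finset.mem_Icc]; exact ⟨le_rfl, hne⟩
  have hmem2 : ⌊2 * y⌋ ∈ dyadZ y := by rw [dyadZ, Finset.mem_Icc]; exact ⟨hne, le_rfl⟩
  have hlo0 : 0 ≤ min (formEval l ⌈y⌉) (formEval l ⌊2 * y⌋) :=
    le_min (hpos _ hmem1) (hpos _ hmem2)
  have hhi0 : 0 ≤ max (formEval l ⌈y⌉) (formEval l ⌊2 * y⌋) :=
    hlo0.trans (min_le_max)
  have hMz : (M : ℤ) = (l.1.natAbs : ℤ) * q := by rw [hM]; push_cast; ring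
  -- divisibility transfer: `M ∣ a (c - n)` iff `q ∣ c - n`
  have hdvd1 : ∀ n : ℤ, (q : ℤ) ∣ c - n → (M : ℤ) ∣ formEval l c - formEval l n := by
    intro n hn
    have : formEval l c - formEval l n = l.1 * (c - n) := by simp only [formEval]; ring
    rw [this, hMz]
    exact mul_dvd_mul (Int.natAbs_dvd.2 dvd_rfl) hn
  have hdvd2 : ∀ n : ℤ, (M : ℤ) ∣ formEval l c - formEval l n → (q : ℤ) ∣ c - n := by
    intro n hn
    have h' : formEval l c - formEval l n = l.1 * (c - n) := by simp only [formEval]; ring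
    rw [h', hMz] at hn
    have h2 := Int.natAbs_dvd_natAbs.2 hn
    rw [Int.natAbs_mul, Int.natAbs_mul, Int.natAbs_natCast, Int.natAbs_natCast] at h2
    exact Int.natCast_dvd.2 (Nat.dvd_of_mul_dvd_mul_left (Int.natAbs_pos.2 ha) h2)
  unfold primeCountZMod
  refine Finset.card_nbij' (fun n => (formEval l n).toNat) (fun p => ((p : ℤ) - l.2) / l.1)
    ?_ ?_ ?_ ?_
  · intro n hn
    rw [Finset.mem_coe, Finset.mem_filter] at hn
    obtain ⟨hnI, hmod, hposn, hprime⟩ := hn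
    dsimp only
    rw [Finset.mem_coe, Finset.mem_filter, Finset.mem_Icc]
    obtain ⟨hb1, hb2⟩ := formEval_mem_Icc (l := l) hnI
    refine ⟨⟨Int.toNat_le_toNat hb1, Int.toNat_le_toNat hb2⟩, ?_, ?_⟩
    · have h1 : ((formEval l n).toNat : ℤ) = (formEval l n).natAbs := by
        rw [Int.toNat_of_nonneg hposn.le, Int.natAbs_of_nonneg hposn.le]
      have h2 : (formEval l n).toNat = (formEval l n).natAbs := by exact_mod_cast h1
      rw [h2]; exact hprime
    · rw [← Int.cast_natCast ((formEval l n).toNat), Int.toNat_of_nonneg hposn.le,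
        ZMod.intCast_eq_intCast_iff_dvd_sub]
      exact hdvd1 n (Int.modEq_iff_dvd.1 hmod)
  · intro p hp
    rw [Finset.mem_coe, Finset.mem_filter, Finset.mem_Icc] at hp
    obtain ⟨⟨hp1, hp2⟩, hprime, hres⟩ := hp
    have hres' : ((p : ℤ) : ZMod M) = ((formEval l c : ℤ) : ZMod M) := by
      rw [Int.cast_natCast]; exact hres
    have hMdvd := (ZMod.intCast_eq_intCast_iff_dvd_sub _ _ _).1 hres'
    -- `a ∣ p - b`
    have hadvd : l.1 ∣ (p : ℤ) - l.2 := by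
      have h1 : l.1 ∣ (M : ℤ) := by
        rw [hMz]; exact Dvd.dvd.mul_right (Int.dvd_natAbs.2 dvd_rfl) _
      have h2 : l.1 ∣ formEval l c - p := h1.trans hMdvd
      have h3 : (p : ℤ) - l.2 = l.1 * c - (formEval l c - p) := by simp only [formEval]; ring
      rw [h3]; exact (Dvd.dvd.mul_right dvd_rfl c).sub h2
    dsimp only
    set n := ((p : ℤ) - l.2) / l.1 with hn
    have hLn : formEval l n = p := by
      simp only [formEval, hn]; rw [Int.mul_ediv_cancel' hadvd]; ring
    rw [Finset.mem_coe, Finset.mem_filter]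
    refine ⟨?_, ?_, ?_, ?_⟩
    · apply mem_dyadZ_of_formEval ha hne
      · rw [hLn]; exact Int.toNat_le.1 hp1
      · rw [hLn]; exact (Int.le_toNat hhi0).1 hp2
    · rw [Int.modEq_iff_dvd]
      apply hdvd2
      rw [hLn]; exact hMdvd
    · rw [hLn]; exact_mod_cast hprime.pos
    · rw [hLn, Int.natAbs_natCast]; exact hprime
  · intro n hn
    rw [Finset.mem_coe, Finset.mem_filter] at hn
    obtain ⟨-, -, hposn, -⟩ := hn
    show (((formEval l n).toNat : ℤ) - l.2) / l.1 = n
    rw [Int.toNat_of_nonneg hposn.le]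
    simp only [formEval]
    rw [add_sub_cancel_right, Int.mul_ediv_cancel_left _ ha]
  · intro p hp
    rw [Finset.mem_coe, Finset.mem_filter, Finset.mem_Icc] at hp
    obtain ⟨-, -, hres⟩ := hp
    have hres' : ((p : ℤ) : ZMod M) = ((formEval l c : ℤ) : ZMod M) := by
      rw [Int.cast_natCast]; exact hres
    have hMdvd := (ZMod.intCast_eq_intCast_iff_dvd_sub _ _ _).1 hres'
    have hadvd : l.1 ∣ (p : ℤ) - l.2 := by
      have h1 : l.1 ∣ (M : ℤ) := by
        rw [hMz]; exact Dvd.dvd.mul_right (Int.dvd_natAbs.2 dvd_rfl) _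
      have h2 : l.1 ∣ formEval l c - p := h1.trans hMdvd
      have h3 : (p : ℤ) - l.2 = l.1 * c - (formEval l c - p) := by simp only [formEval]; ring
      rw [h3]; exact (Dvd.dvd.mul_right dvd_rfl c).sub h2
    show (formEval l (((p : ℤ) - l.2) / l.1)).toNat = p
    have : formEval l (((p : ℤ) - l.2) / l.1) = p := by
      simp only [formEval]; rw [Int.mul_ediv_cancel' hadvd]; ring
    rw [this, Int.toNat_natCast]

/-- `primeCountZ` is the `q = 1` case of `primeCountZMod`. [folklore] -/
private theorem primeCountZ_eq_primeCountZMod_one (l : ℤ × ℤ) (y : ℝ) (c : ℤ) :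
    primeCountZ l y = primeCountZMod l y 1 c := by
  unfold primeCountZ primeCountZMod
  congr 1
  refine Finset.filter_congr fun n _ => ?_
  simp only [Nat.cast_one, Int.modEq_one, true_and]

/-- `gcd(a c + b, |a| q) = 1` from `gcd(a, b) = 1` and `gcd(a c + b, q) = 1`. [folklore] -/
private theorem int_gcd_formEval_eq_one {a b c : ℤ} {q : ℕ} (hab : Int.gcd a b = 1)
    (hq : Int.gcd (a * c + b) q = 1) : Int.gcd (a * c + b) ((a.natAbs * q : ℕ) : ℤ) = 1 := by
  have h1 : Int.gcd (a * c + b) a = 1 := by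
    rw [← Int.isCoprime_iff_gcd_eq_one] at hab ⊢
    have := (hab.symm).add_mul_left_left c
    rwa [add_comm] at this
  rw [Int.gcd_eq_natAbs] at h1 hq ⊢
  rw [Int.natAbs_natCast] at hq ⊢
  exact Nat.Coprime.mul_right h1 hq

/-- An integer coprime to `M` is a unit of `ZMod M`. [folklore] -/
private theorem isUnit_of_int_gcd_eq_one {M : ℕ} {z : ℤ} (h : Int.gcd z M = 1) :
    IsUnit ((z : ℤ) : ZMod M) := by
  rw [ZMod.coe_int_isUnit_iff_isCoprime, Int.isCoprime_iff_gcd_eq_one, Int.gcd_comm]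
  exact h

/-! ### Counting primes in a progression on an interval via `primeCountingDisc` -/

/-- `#{p ∈ [Vl,Vh] prime, p ≡ r} - #{p ∈ [Vl,Vh] prime}/φ(M)` as a sum of the summand of
`primeCountingDisc` over `[Vl, Vh]`. [folklore] -/
private theorem card_filter_sub_div_eq (Vl Vh M : ℕ) (r : ZMod M) :
    (#((Icc Vl Vh).filter (fun p : ℕ => p.Prime ∧ (p : ZMod M) = r)) : ℝ) -
        #((Icc Vl Vh).filter Nat.Prime) / Nat.totient M =
      ∑ n ∈ Icc Vl Vh, (if n.Prime then apIndicator M r n - 1 / Nat.totient M else 0) := by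
  rw [Finset.sum_ite, Finset.sum_const_zero, add_zero, Finset.sum_sub_distrib,
    Finset.sum_const, nsmul_eq_mul]
  have h1 : ∑ n ∈ (Icc Vl Vh).filter Nat.Prime, apIndicator M r n =
      #((Icc Vl Vh).filter (fun p : ℕ => p.Prime ∧ (p : ZMod M) = r)) := by
    simp only [apIndicator]
    rw [Finset.sum_boole, Finset.filter_filter]
  rw [h1]
  ring

/-- A sum over `[Vl, Vh]` of the `primeCountingDisc` summand is a difference of two values of
`primeCountingDisc`. [folklore] -/
private theorem sum_Icc_eq_primeCountingDisc_sub (Vl Vh M : ℕ) (r : ZMod M) (hV : Vl ≤ Vh + 1) :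
    ∑ n ∈ Icc Vl Vh, (if n.Prime then apIndicator M r n - 1 / Nat.totient M else 0) =
      primeCountingDisc M r Vh - (if Vl = 0 then 0 else primeCountingDisc M r (Vl - 1)) := by
  rw [← Finset.Ico_add_one_right_eq_Icc, Finset.sum_Ico_eq_sub _ hV]
  congr 1
  split_ifs with h0
  · rw [h0, Finset.sum_range_zero]
  · rw [primeCountingDisc, Nat.sub_add_cancel (Nat.one_le_iff_ne_zero.2 h0)]

/-- `∑_{p ∈ [Vl, Vh]} log p = θ(Vh) - θ(Vl - 1)`. [folklore] -/
private theorem sum_Icc_log_eq_theta_sub (Vl Vh : ℕ) (hV : Vl ≤ Vh + 1) :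
    ∑ n ∈ Icc Vl Vh, (if n.Prime then Real.log n else 0) =
      Chebyshev.theta Vh - (if Vl = 0 then 0 else Chebyshev.theta ((Vl - 1 : ℕ) : ℝ)) := by
  rw [← Finset.Ico_add_one_right_eq_Icc, Finset.sum_Ico_eq_sub _ hV,
    ← chebyshevTheta_natCast_eq_sum_range]
  congr 1
  split_ifs with h0
  · rw [h0, Finset.sum_range_zero]
  · rw [chebyshevTheta_natCast_eq_sum_range, Nat.sub_add_cancel (Nat.one_le_iff_ne_zero.2 h0)]

/-- The discrepancy of primes `≡ u (mod M)` in `[0, N]`, `N ≤ X`, in terms of a majorant `AM` of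
`|ψ(n; M, u) - n/φ(M)|`, a majorant `A1` of `|ψ(n) - n|` and a majorant `S` of `ψ(n) - θ(n)`
on `n ≤ X` (partial summation). [cite: FordGreenKonyaginMaynardTao2018, §7 proof of Lemma 7.2]
[cite: DavenportMNT1980, Ch. 28] -/
private theorem abs_primeCountingDisc_le_of_majorants {X S A1 AM : ℝ} {M : ℕ} (hM : M ≠ 0)
    (u : (ZMod M)ˣ)
    (hAM : ∀ n : ℕ, (n : ℝ) ≤ X →
      |ParityWave0.chebyshevPsiMod M (u : ZMod M) n - n / Nat.totient M| ≤ AM)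
    (hA1 : ∀ n : ℕ, (n : ℝ) ≤ X → |Chebyshev.psi n - n| ≤ A1)
    (hS : ∀ n : ℕ, (n : ℝ) ≤ X → Chebyshev.psi n - Chebyshev.theta n ≤ S)
    {N : ℕ} (hN : (N : ℝ) ≤ X) :
    |primeCountingDisc M (u : ZMod M) N| ≤ 2 * (AM + (A1 + S) / Nat.totient M + S) := by
  have hφ : (0 : ℝ) < Nat.totient M := by
    exact_mod_cast Nat.totient_pos.2 (Nat.pos_of_ne_zero hM)
  have hbound : ∀ n ≤ N, |chebyshevThetaDisc M (u : ZMod M) n| ≤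
      AM + (A1 + S) / Nat.totient M + S := by
    intro n hn
    have hnX : (n : ℝ) ≤ X := (Nat.cast_le.2 hn).trans hN
    refine (abs_chebyshevThetaDisc_le M _ n).trans ?_
    have h1 : |chebyshevPsiDisc M (u : ZMod M) n| ≤ AM := hAM n hnX
    have h2 := hA1 n hnX
    have h3 := hS n hnX
    have h4 : chebyshevPsiModNotPrime M (u : ZMod M) n ≤ S :=
      (chebyshevPsiModNotPrime_le M _ n).trans h3
    have h5 : (|Chebyshev.psi n - n| + (Chebyshev.psi n - Chebyshev.theta n)) / Nat.totient M ≤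
        (A1 + S) / Nat.totient M := div_le_div_of_nonneg_right (add_le_add h2 h3) hφ.le
    linarith
  have h := abs_primeCountingDisc_le hbound
  have hT0 : 0 ≤ AM + (A1 + S) / Nat.totient M + S := by
    have := hbound 0 (Nat.zero_le N)
    exact (abs_nonneg _).trans this
  have hl2 : (1 : ℝ) / Real.log 2 ≤ 2 := by
    rw [div_le_iff₀ (Real.log_pos one_lt_two)]
    have := Real.log_two_gt_d9; linarith
  calc |primeCountingDisc M (u : ZMod M) N| ≤ (AM + (A1 + S) / Nat.totient M + S) / Real.log 2 := h
    _ = (AM + (A1 + S) / Nat.totient M + S) * (1 / Real.log 2) := by ring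
    _ ≤ (AM + (A1 + S) / Nat.totient M + S) * 2 := mul_le_mul_of_nonneg_left hl2 hT0
    _ = 2 * (AM + (A1 + S) / Nat.totient M + S) := by ring

/-- Primes in a reduced class on an interval `[Vl, Vh] ⊆ [0, X]`: the count differs from
`#{primes in [Vl, Vh]}/φ(M)` by at most `4 (AM + (A1 + S)/φ(M) + S)`.
[cite: FordGreenKonyaginMaynardTao2018, §7 proof of Lemma 7.2] -/
private theorem abs_card_sub_div_le {X S A1 AM : ℝ} {M : ℕ} (hM : M ≠ 0) (u : (ZMod M)ˣ)
    (hAM : ∀ n : ℕ, (n : ℝ) ≤ X →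
      |ParityWave0.chebyshevPsiMod M (u : ZMod M) n - n / Nat.totient M| ≤ AM)
    (hA1 : ∀ n : ℕ, (n : ℝ) ≤ X → |Chebyshev.psi n - n| ≤ A1)
    (hS : ∀ n : ℕ, (n : ℝ) ≤ X → Chebyshev.psi n - Chebyshev.theta n ≤ S)
    {Vl Vh : ℕ} (hV : Vl ≤ Vh) (hVh : (Vh : ℝ) ≤ X) :
    |(#((Icc Vl Vh).filter (fun p : ℕ => p.Prime ∧ (p : ZMod M) = (u : ZMod M))) : ℝ) -
        #((Icc Vl Vh).filter Nat.Prime) / Nat.totient M| ≤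
      4 * (AM + (A1 + S) / Nat.totient M + S) := by
  rw [card_filter_sub_div_eq, sum_Icc_eq_primeCountingDisc_sub _ _ _ _ (by omega)]
  have h1 := abs_primeCountingDisc_le_of_majorants hM u hAM hA1 hS hVh
  have hT0 : 0 ≤ AM + (A1 + S) / Nat.totient M + S := by
    have := (abs_nonneg _).trans h1; linarith
  split_ifs with h0
  · rw [sub_zero]; linarith
  · have hVl : (((Vl - 1 : ℕ)) : ℝ) ≤ X := by
      have : ((Vl - 1 : ℕ) : ℝ) ≤ Vh := by exact_mod_cast (by omega : Vl - 1 ≤ Vh)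
      exact this.trans hVh
    have h2 := abs_primeCountingDisc_le_of_majorants hM u hAM hA1 hS hVl
    calc |primeCountingDisc M (u : ZMod M) Vh - primeCountingDisc M (u : ZMod M) (Vl - 1)|
        ≤ |primeCountingDisc M (u : ZMod M) Vh| + |primeCountingDisc M (u : ZMod M) (Vl - 1)| :=
          abs_sub _ _
      _ ≤ _ := by linarith

/-- Lower bound for the number of primes in `[Vl, Vh] ⊆ [0, X]`:
`#{p ∈ [Vl, Vh]} · log X ≥ (Vh - Vl) - 2 A1 - S` (Chebyshev `θ` via `ψ`). [cite: FordGreenKonyaginMaynardTao2018, §7 proof of Lemma 7.2] -/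
private theorem card_primes_Icc_mul_log_ge {X S A1 : ℝ} (hX : 1 ≤ X)
    (hA1 : ∀ n : ℕ, (n : ℝ) ≤ X → |Chebyshev.psi n - n| ≤ A1)
    (hS : ∀ n : ℕ, (n : ℝ) ≤ X → Chebyshev.psi n - Chebyshev.theta n ≤ S)
    {Vl Vh : ℕ} (hV : Vl ≤ Vh) (hVh : (Vh : ℝ) ≤ X) :
    ((Vh : ℝ) - Vl) - 2 * A1 - S ≤ #((Icc Vl Vh).filter Nat.Prime) * Real.log X := by
  have hA10 : 0 ≤ A1 := (abs_nonneg _).trans (hA1 0 (by simp; linarith))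
  -- the θ-sum over the interval is at most (#primes) · log X
  have hup : ∑ n ∈ Icc Vl Vh, (if n.Prime then Real.log n else 0) ≤
      #((Icc Vl Vh).filter Nat.Prime) * Real.log X := by
    rw [Finset.sum_ite, Finset.sum_const_zero, add_zero]
    have : ∀ n ∈ (Icc Vl Vh).filter Nat.Prime, Real.log n ≤ Real.log X := by
      intro n hn
      rw [Finset.mem_filter, Finset.mem_Icc] at hn
      have hn0 : (0 : ℝ) < n := by exact_mod_cast hn.2.pos
      exact Real.log_le_log hn0 ((Nat.cast_le.2 hn.1.2).trans hVh)
    refine (Finset.sum_le_sum this).trans ?_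
    rw [Finset.sum_const, nsmul_eq_mul]
  -- the θ-sum is θ(Vh) - θ(Vl - 1) ≥ (Vh - A1 - S) - (Vl - 1 + A1)
  have hlow : ((Vh : ℝ) - Vl) - 2 * A1 - S ≤
      ∑ n ∈ Icc Vl Vh, (if n.Prime then Real.log n else 0) := by
    rw [sum_Icc_log_eq_theta_sub _ _ (by omega)]
    have hθh : (Vh : ℝ) - A1 - S ≤ Chebyshev.theta Vh := by
      have h1 := hA1 Vh hVh
      have h2 := hS Vh hVh
      have h3 := (abs_le.1 h1).1
      linarith
    split_ifs with h0
    · have : (Vl : ℝ) = 0 := by exact_mod_cast h0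
      rw [this]; linarith
    · have hVl : ((Vl - 1 : ℕ) : ℝ) ≤ X :=
        le_trans (by exact_mod_cast (by omega : Vl - 1 ≤ Vh)) hVh
      have h1 := hA1 (Vl - 1) hVl
      have h2 := (abs_le.1 h1).2
      have h3 := Chebyshev.theta_le_psi ((Vl - 1 : ℕ) : ℝ)
      have h4 : ((Vl - 1 : ℕ) : ℝ) = (Vl : ℝ) - 1 := by
        rw [Nat.cast_sub (Nat.one_le_iff_ne_zero.2 h0), Nat.cast_one]
      rw [h4] at h2 h3 ⊢
      linarith
  exact hlow.trans hup

/-! ### Two pieces of real arithmetic (kept out of the main proof's large context) -/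

/-- Real arithmetic: the majorant side `4R + 4 S Q₀ + Z (1 + LQ)² ≤ 104 (R + X^{5/6}) log³ X`.
[folklore] -/
private theorem majorant_arith {X R S Z Q₀ LQ : ℝ} (hX1 : 1 ≤ X) (hlogX1 : 1 ≤ Real.log X)
    (hR0 : 0 ≤ R) (hS : S = 2 * Real.sqrt X * Real.log X)
    (hQ₀X : Q₀ ≤ X ^ ((1 : ℝ) / 3)) (hLQ0 : 0 ≤ LQ) (hLQ : LQ ≤ Real.log X)
    (hZ : Z ≤ 12 * R + 12 * S) :
    4 * R + 4 * S * Q₀ + Z * (1 + LQ) ^ 2 ≤ 104 * (R + X ^ ((5 : ℝ) / 6)) * Real.log X ^ 3 := by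
  have hX0 : 0 < X := by linarith
  have hlogX0 : 0 < Real.log X := by linarith
  have hS0 : 0 ≤ S := by rw [hS]; positivity
  have hsqrtX : Real.sqrt X * X ^ ((1 : ℝ) / 3) = X ^ ((5 : ℝ) / 6) := by
    rw [Real.sqrt_eq_rpow, ← Real.rpow_add hX0]; norm_num
  have hsqrtX' : Real.sqrt X ≤ X ^ ((5 : ℝ) / 6) := by
    rw [Real.sqrt_eq_rpow]; exact Real.rpow_le_rpow_of_exponent_le hX1 (by norm_num)
  have hX56 : 0 ≤ X ^ ((5 : ℝ) / 6) := by positivity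
  set P := X ^ ((5 : ℝ) / 6) with hP
  set L := Real.log X with hL
  have e1 : 4 * S * Q₀ ≤ 8 * P * L := by
    rw [hS]
    have := mul_le_mul_of_nonneg_left hQ₀X (by positivity : (0 : ℝ) ≤ 8 * Real.sqrt X * L)
    calc 4 * (2 * Real.sqrt X * L) * Q₀ = 8 * Real.sqrt X * L * Q₀ := by ring
      _ ≤ 8 * Real.sqrt X * L * X ^ ((1 : ℝ) / 3) := this
      _ = 8 * (Real.sqrt X * X ^ ((1 : ℝ) / 3)) * L := by ring
      _ = 8 * P * L := by rw [hsqrtX]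
  have e2 : (1 + LQ) ^ 2 ≤ 4 * L ^ 2 := by nlinarith
  have e4 : Z * (1 + LQ) ^ 2 ≤ (12 * R + 12 * S) * (4 * L ^ 2) :=
    mul_le_mul hZ e2 (by positivity) (by positivity)
  have e5 : S ≤ 2 * P * L := by
    rw [hS]; exact mul_le_mul_of_nonneg_right (by linarith) hlogX0.le
  have hL2 : L ≤ L ^ 2 := by nlinarith
  have hL3 : L ^ 2 ≤ L ^ 3 := by nlinarith
  have hL13 : (1 : ℝ) ≤ L ^ 3 := by nlinarith
  have t1 : 4 * R ≤ 4 * R * L ^ 3 := by nlinarith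
  have t2 : 8 * P * L ≤ 8 * P * L ^ 3 := by nlinarith
  have t3 : 12 * S * (4 * L ^ 2) ≤ 96 * P * L ^ 3 := by
    have := mul_le_mul_of_nonneg_right e5 (by positivity : (0 : ℝ) ≤ 48 * L ^ 2)
    nlinarith
  have t4 : 12 * R * (4 * L ^ 2) ≤ 48 * R * L ^ 3 := by nlinarith
  nlinarith

/-- Real arithmetic: the lower bound `y/2 ≤ primeCountZ · log X` from the prime count on the
value interval. [folklore] -/
private theorem lowerBound_arith {y tot ca φa aR D A1 R S LX : ℝ}
    (hca : tot / φa - 8 * (R + S) ≤ ca) (htotlog : aR * D - 2 * A1 - S ≤ tot * LX)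
    (hlen : y - 2 ≤ D) (hD0 : 0 ≤ D) (hφa1 : 1 ≤ φa) (hφale : φa ≤ aR) (htot0 : 0 ≤ tot)
    (hLX : 0 < LX) (hA1R : A1 ≤ R) (hA10 : 0 ≤ A1) (hS0 : 0 ≤ S)
    (hJ : 2 + 2 * R + S + 8 * (R + S) * LX ≤ y / 2) : y / 2 ≤ ca * LX := by
  have hφa : 0 < φa := by linarith
  set W₁ := D - 2 * A1 - S with hW₁
  have hkey : W₁ * φa ≤ tot * LX := by
    rcases le_or_gt W₁ 0 with hW | hW
    · have : 0 ≤ tot * LX := by positivity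
      nlinarith
    · have e1 : aR * W₁ ≤ tot * LX := by
        have : aR * W₁ ≤ aR * D - 2 * A1 - S := by rw [hW₁]; nlinarith
        linarith
      nlinarith
  have e2 : W₁ - 8 * (R + S) * LX ≤ ca * LX := by
    have := mul_le_mul_of_nonneg_right hca hLX.le
    rw [sub_mul, div_mul_eq_mul_div] at this
    have h3 : W₁ ≤ tot * LX / φa := by rw [le_div_iff₀ hφa]; exact hkey
    linarith
  have e3 : y - (2 + 2 * R + S + 8 * (R + S) * LX) ≤ W₁ - 8 * (R + S) * LX := by
    rw [hW₁]; linarith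
  linarith

/-! ### The core estimate with all analytic data explicit -/

/-- Hypothesis 1 at `θ = 1/3`, `C_H = 1`, from a majorant `A` as produced by `bvMax_of_bv` at
height `X` (with `∑_{m ≤ Q, (m,B)=1} A m ≤ R`), provided the values of the form on the block lie
in `[0, X]`, `|a| y^{1/3} ≤ Q`, and the two numerical inequalities `hJ`, `hU` hold.
[cite: FordGreenKonyaginMaynardTao2018, §7 proof of Lemma 7.2] -/
private theorem hypothesisOneZ_of_majorant {X R S : ℝ} {A : ℕ → ℝ} {B Q k : ℕ} {l : ℤ × ℤ}
    {y : ℝ} (hX1 : 1 ≤ X) (hlogX1 : 1 ≤ Real.log X) (hA0 : ∀ m, 0 ≤ A m)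
    (hAprop : ∀ (m : ℕ), m ≠ 0 → ∀ (u : (ZMod m)ˣ) (n : ℕ), (n : ℝ) ≤ X →
      |ParityWave0.chebyshevPsiMod m u n - n / Nat.totient m| ≤ A m)
    (hAsum : ∑ m ∈ (Icc 1 Q).filter (fun m => Nat.Coprime m B), A m ≤ R)
    (hS : S = 2 * Real.sqrt X * Real.log X)
    (ha : l.1 ≠ 0) (hgcd : Int.gcd l.1 l.2 = 1) (hcop : Nat.Coprime l.1.natAbs B)
    (hy1 : 1 < y) (hyX : y ≤ X) (hpos : ∀ n ∈ dyadZ y, 0 ≤ formEval l n)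
    (hvals : ∀ n ∈ dyadZ y, ((formEval l n : ℤ) : ℝ) ≤ X)
    (haQ : l.1.natAbs * ⌊y ^ ((1 : ℝ) / 3)⌋₊ ≤ Q)
    (hJ : 2 + 2 * R + S + 8 * (R + S) * Real.log X ≤ y / 2)
    (hU : 2 * Real.log X * Real.log X ^ (100 * k ^ 2) *
      (104 * (R + X ^ ((5 : ℝ) / 6)) * Real.log X ^ 3) ≤ y) :
    HypothesisOneZ ((1 : ℝ) / 3) B k y l 1 := by
  intro cq
  have hX0 : 0 < X := by linarith
  have hlogX0 : 0 < Real.log X := by linarith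
  have ha0 : l.1.natAbs ≠ 0 := Int.natAbs_ne_zero.2 ha
  have ha1 : 1 ≤ l.1.natAbs := Nat.one_le_iff_ne_zero.2 ha0
  set Q₀ := ⌊y ^ ((1 : ℝ) / 3)⌋₊ with hQ₀def
  set F₀ := (Icc 1 Q₀).filter (fun q => Nat.Coprime q B) with hF₀def
  -- the block and the value interval
  have hy0 : 0 < y := by linarith
  have hne : ⌈y⌉ ≤ ⌊2 * y⌋ := by
    rw [Int.le_floor]; have := Int.ceil_lt_add_one y; linarith
  have hmem1 : ⌈y⌉ ∈ dyadZ y := by rw [dyadZ, Finset.mem_Icc]; exact ⟨le_rfl, hne⟩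
  have hmem2 : ⌊2 * y⌋ ∈ dyadZ y := by rw [dyadZ, Finset.mem_Icc]; exact ⟨hne, le_rfl⟩
  set vlo := min (formEval l ⌈y⌉) (formEval l ⌊2 * y⌋) with hvlo
  set vhi := max (formEval l ⌈y⌉) (formEval l ⌊2 * y⌋) with hvhi
  have hlo0 : 0 ≤ vlo := le_min (hpos _ hmem1) (hpos _ hmem2)
  have hhi0 : 0 ≤ vhi := hlo0.trans min_le_max
  set Vl := vlo.toNat with hVl
  set Vh := vhi.toNat with hVh
  have hV : Vl ≤ Vh := Int.toNat_le_toNat min_le_max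
  have hVhR : (Vh : ℝ) = ((vhi : ℤ) : ℝ) := by exact_mod_cast Int.toNat_of_nonneg hhi0
  have hVlR : (Vl : ℝ) = ((vlo : ℤ) : ℝ) := by exact_mod_cast Int.toNat_of_nonneg hlo0
  have hVhX : (Vh : ℝ) ≤ X := by
    rw [hVhR, hvhi, Int.cast_max]
    exact max_le (hvals _ hmem1) (hvals _ hmem2)
  -- the majorants `A 1` (for `ψ(n) - n`) and `S` (for `ψ(n) - θ(n)`)
  have hA1 : ∀ n : ℕ, (n : ℝ) ≤ X → |Chebyshev.psi n - n| ≤ A 1 := by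
    intro n hn
    have := hAprop 1 one_ne_zero 1 n hn
    rwa [ParityWave0.chebyshevPsiMod_one, Nat.totient_one, Nat.cast_one, div_one] at this
  have hS0 : 0 ≤ S := by rw [hS]; positivity
  have hSprop : ∀ n : ℕ, (n : ℝ) ≤ X → Chebyshev.psi n - Chebyshev.theta n ≤ S := by
    intro n hn
    rcases Nat.eq_zero_or_pos n with h0 | hnpos
    · subst h0
      rw [chebyshevPsi_natCast_eq_sum_range, chebyshevTheta_natCast_eq_sum_range]
      simp only [zero_add, Finset.sum_range_one, Nat.cast_zero, ArithmeticFunction.map_zero,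
        Nat.not_prime_zero, if_false, sub_zero]
      exact hS0
    · have h1 : (1 : ℝ) ≤ n := by exact_mod_cast hnpos
      calc Chebyshev.psi n - Chebyshev.theta n ≤ 2 * Real.sqrt n * Real.log n :=
            Chebyshev.psi_sub_theta_le h1
        _ ≤ 2 * Real.sqrt X * Real.log X :=
            mul_le_mul (mul_le_mul_of_nonneg_left (Real.sqrt_le_sqrt hn) (by norm_num))
              (Real.log_le_log (by positivity) hn) (Real.log_nonneg h1) (by positivity)
        _ = S := hS.symm
  have hA10 : 0 ≤ A 1 := hA0 1
  have hR0 : 0 ≤ R := le_trans (Finset.sum_nonneg fun m _ => hA0 m) hAsum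
  -- `A m ≤ R` for the moduli `1` and `|a|`
  have hQ₀1 : 1 ≤ Q₀ := by
    rw [hQ₀def]
    refine Nat.le_floor ?_
    rw [Nat.cast_one]
    exact Real.one_le_rpow hy1.le (by norm_num)
  have hQ1 : 1 ≤ Q := le_trans (Nat.one_le_iff_ne_zero.2 (Nat.mul_ne_zero ha0 (by omega))) haQ
  have haQ' : l.1.natAbs ≤ Q := le_trans (Nat.le_mul_of_pos_right _ (by omega)) haQ
  have hAleR : ∀ m ∈ (Icc 1 Q).filter (fun m => Nat.Coprime m B), A m ≤ R := fun m hm =>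
    (Finset.single_le_sum (fun i _ => hA0 i) hm).trans hAsum
  have hA1R : A 1 ≤ R := hAleR 1 (by
    rw [Finset.mem_filter, Finset.mem_Icc]; exact ⟨⟨le_rfl, hQ1⟩, Nat.coprime_one_left B⟩)
  have hAaR : A l.1.natAbs ≤ R := hAleR _ (by
    rw [Finset.mem_filter, Finset.mem_Icc]; exact ⟨⟨ha1, haQ'⟩, hcop⟩)
  -- totients
  have hφa : (0 : ℝ) < Nat.totient l.1.natAbs := by
    exact_mod_cast Nat.totient_pos.2 (Nat.pos_of_ne_zero ha0)
  have hφa1 : (1 : ℝ) ≤ Nat.totient l.1.natAbs := by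
    exact_mod_cast Nat.totient_pos.2 (Nat.pos_of_ne_zero ha0)
  have hφale : (Nat.totient l.1.natAbs : ℝ) ≤ l.1.natAbs := by
    exact_mod_cast Nat.totient_le _
  -- the number of primes in the value interval
  set tot := (#((Icc Vl Vh).filter Nat.Prime) : ℝ) with htot
  have htot0 : 0 ≤ tot := Nat.cast_nonneg _
  ------------------------------------------------------------------
  -- Step 1: the per-modulus bound
  ------------------------------------------------------------------
  set Z := 8 * A 1 + 4 * A l.1.natAbs + 12 * S with hZ
  have hZ0 : 0 ≤ Z := by have := hA0 l.1.natAbs; rw [hZ]; positivity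
  set β : ℕ → ℝ := fun q => 4 * A (l.1.natAbs * q) + 4 * S + Z / Nat.totient q with hβ
  have hterm : ∀ q ∈ F₀,
      (if Int.gcd (formEval l (cq q)) q = 1 then
          |(primeCountZMod l y q (cq q) : ℝ) - primeCountZ l y / totForm l q| else 0) ≤ β q := by
    intro q hq
    obtain ⟨hqI, hqB⟩ := Finset.mem_filter.1 hq
    obtain ⟨hq1, hqQ₀⟩ := Finset.mem_Icc.1 hqI
    have hq0 : q ≠ 0 := by omega
    have hφq : (0 : ℝ) < Nat.totient q := by exact_mod_cast Nat.totient_pos.2 (by omega)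
    split_ifs with hg
    · set M := l.1.natAbs * q with hMdef
      have hM0 : M ≠ 0 := Nat.mul_ne_zero ha0 hq0
      have hφM : (0 : ℝ) < Nat.totient M := by
        exact_mod_cast Nat.totient_pos.2 (Nat.pos_of_ne_zero hM0)
      have hφmul : (Nat.totient l.1.natAbs : ℝ) * Nat.totient q ≤ Nat.totient M := by
        rw [hMdef]; exact_mod_cast Nat.totient_super_multiplicative _ _
      have hφqM : (Nat.totient q : ℝ) ≤ Nat.totient M :=
        le_trans (le_mul_of_one_le_left hφq.le hφa1) hφmul
      -- the residues are units
      have hgM : Int.gcd (l.1 * cq q + l.2) ((l.1.natAbs * q : ℕ) : ℤ) = 1 :=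
        int_gcd_formEval_eq_one hgcd hg
      obtain ⟨uM, huMeq⟩ : IsUnit (((formEval l (cq q) : ℤ)) : ZMod M) :=
        isUnit_of_int_gcd_eq_one hgM
      have hga : Int.gcd (l.1 * cq q + l.2) ((l.1.natAbs * 1 : ℕ) : ℤ) = 1 :=
        int_gcd_formEval_eq_one hgcd (by simp)
      obtain ⟨ua, huaeq⟩ : IsUnit (((formEval l (cq q) : ℤ)) : ZMod l.1.natAbs) :=
        isUnit_of_int_gcd_eq_one (by simpa only [formEval, mul_one] using hga)
      -- the two counts as primes in progressions on `[Vl, Vh]`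
      have hPCM : primeCountZMod l y q (cq q) =
          #((Icc Vl Vh).filter (fun p : ℕ => p.Prime ∧ (p : ZMod M) = (uM : ZMod M))) := by
        rw [huMeq]; exact primeCountZMod_eq_card ha hne hpos (cq q) hMdef
      have hPC : primeCountZ l y =
          #((Icc Vl Vh).filter (fun p : ℕ => p.Prime ∧
            (p : ZMod l.1.natAbs) = (ua : ZMod l.1.natAbs))) := by
        rw [huaeq, primeCountZ_eq_primeCountZMod_one l y (cq q)]
        exact primeCountZMod_eq_card ha hne hpos (cq q) (by simp)
      have hDm := abs_card_sub_div_le hM0 uM (hAprop M hM0 uM) hA1 hSprop hV hVhX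
      have hDa := abs_card_sub_div_le ha0 ua (hAprop _ ha0 ua) hA1 hSprop hV hVhX
      have htotForm : totForm l q = (Nat.totient M : ℝ) / Nat.totient l.1.natAbs := rfl
      rw [hPCM, hPC, htotForm]
      set cM := (#((Icc Vl Vh).filter (fun p : ℕ => p.Prime ∧ (p : ZMod M) = (uM : ZMod M))) : ℝ)
      set ca := (#((Icc Vl Vh).filter (fun p : ℕ => p.Prime ∧
            (p : ZMod l.1.natAbs) = (ua : ZMod l.1.natAbs))) : ℝ)
      have hid : cM - ca / ((Nat.totient M : ℝ) / Nat.totient l.1.natAbs) =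
          (cM - tot / Nat.totient M) -
            (ca - tot / Nat.totient l.1.natAbs) * ((Nat.totient l.1.natAbs : ℝ) / Nat.totient M) := by
        field_simp
        ring
      rw [hid]
      have h1 : (A 1 + S) / Nat.totient M ≤ (A 1 + S) / Nat.totient q :=
        div_le_div_of_nonneg_left (by positivity) hφq hφqM
      have h2 : (A 1 + S) / Nat.totient l.1.natAbs ≤ A 1 + S :=
        div_le_self (by positivity) hφa1
      have h3 : (Nat.totient l.1.natAbs : ℝ) / Nat.totient M ≤ 1 / Nat.totient q := by
        rw [div_le_div_iff₀ hφM hφq]; linarith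
      have hAa0 := hA0 l.1.natAbs
      have h4 : 4 * (A l.1.natAbs + (A 1 + S) / Nat.totient l.1.natAbs + S) *
            ((Nat.totient l.1.natAbs : ℝ) / Nat.totient M) ≤
          4 * (A l.1.natAbs + A 1 + 2 * S) * (1 / Nat.totient q) :=
        mul_le_mul (by linarith) h3 (by positivity) (by positivity)
      calc |(cM - tot / Nat.totient M) -
              (ca - tot / Nat.totient l.1.natAbs) * ((Nat.totient l.1.natAbs : ℝ) / Nat.totient M)|
          ≤ |cM - tot / Nat.totient M| +
              |(ca - tot / Nat.totient l.1.natAbs) * ((Nat.totient l.1.natAbs : ℝ) / Nat.totient M)| :=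
            abs_sub _ _
        _ = |cM - tot / Nat.totient M| +
              |ca - tot / Nat.totient l.1.natAbs| * ((Nat.totient l.1.natAbs : ℝ) / Nat.totient M) := by
            rw [abs_mul, abs_of_nonneg (by positivity : (0 : ℝ) ≤ _ / _)]
        _ ≤ 4 * (A M + (A 1 + S) / Nat.totient M + S) +
              4 * (A l.1.natAbs + (A 1 + S) / Nat.totient l.1.natAbs + S) *
                ((Nat.totient l.1.natAbs : ℝ) / Nat.totient M) :=
            add_le_add hDm (mul_le_mul_of_nonneg_right hDa (by positivity))
        _ ≤ 4 * (A M + (A 1 + S) / Nat.totient q + S) +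
              4 * (A l.1.natAbs + A 1 + 2 * S) * (1 / Nat.totient q) := by linarith
        _ = β q := by
            simp only [hβ, hZ, hMdef]
            field_simp
            ring
    · have := hA0 (l.1.natAbs * q)
      simp only [hβ]
      positivity
  ------------------------------------------------------------------
  -- Step 2: summing the per-modulus bound
  ------------------------------------------------------------------
  have hsumA : ∑ q ∈ F₀, A (l.1.natAbs * q) ≤ R := by
    have hinj : Set.InjOn (fun q : ℕ => l.1.natAbs * q) ↑F₀ := fun q₁ _ q₂ _ h =>
      Nat.eq_of_mul_eq_mul_left (Nat.pos_of_ne_zero ha0) h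
    rw [← Finset.sum_image hinj]
    refine le_trans (Finset.sum_le_sum_of_subset_of_nonneg ?_ fun m _ _ => hA0 m) hAsum
    intro m hm
    simp only [Finset.mem_image] at hm
    obtain ⟨q, hq, rfl⟩ := hm
    obtain ⟨hqI, hqB⟩ := Finset.mem_filter.1 hq
    obtain ⟨hq1, hqQ₀⟩ := Finset.mem_Icc.1 hqI
    rw [Finset.mem_filter, Finset.mem_Icc]
    refine ⟨⟨Nat.one_le_iff_ne_zero.2 (Nat.mul_ne_zero ha0 (by omega)),
      le_trans (Nat.mul_le_mul_left _ hqQ₀) haQ⟩, Nat.coprime_mul_iff_left.2 ⟨hcop, hqB⟩⟩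
  have hcardF₀ : (#F₀ : ℝ) ≤ Q₀ := by
    have : #F₀ ≤ Q₀ := (Finset.card_filter_le _ _).trans (by simp [Nat.card_Icc])
    exact_mod_cast this
  have hsumφ : ∑ q ∈ F₀, ((Nat.totient q : ℝ))⁻¹ ≤ (1 + Real.log Q₀) ^ 2 :=
    le_trans (Finset.sum_le_sum_of_subset_of_nonneg (Finset.filter_subset _ _)
      fun _ _ _ => inv_nonneg.2 (Nat.cast_nonneg _)) (totientInvSum_le Q₀)
  have hsumβ : ∑ q ∈ F₀, β q ≤ 4 * R + 4 * S * Q₀ + Z * (1 + Real.log Q₀) ^ 2 := by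
    have hsplit : ∑ q ∈ F₀, β q =
        4 * ∑ q ∈ F₀, A (l.1.natAbs * q) + 4 * S * #F₀ + Z * ∑ q ∈ F₀, ((Nat.totient q : ℝ))⁻¹ := by
      simp only [hβ, Finset.sum_add_distrib, Finset.sum_const, nsmul_eq_mul, ← Finset.mul_sum,
        div_eq_mul_inv]
      ring
    rw [hsplit]
    have e1 := mul_le_mul_of_nonneg_left hsumA (by norm_num : (0 : ℝ) ≤ 4)
    have e2 := mul_le_mul_of_nonneg_left hcardF₀ (by positivity : (0 : ℝ) ≤ 4 * S)
    have e3 := mul_le_mul_of_nonneg_left hsumφ hZ0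
    linarith
  ------------------------------------------------------------------
  -- Step 3: the crude majorant `U = 104 (R + X^{5/6}) log³ X`
  ------------------------------------------------------------------
  have hQ₀X : (Q₀ : ℝ) ≤ X ^ ((1 : ℝ) / 3) := by
    rw [hQ₀def]
    exact (Nat.floor_le (by positivity)).trans (Real.rpow_le_rpow hy0.le hyX (by norm_num))
  have hlogQ₀ : Real.log Q₀ ≤ Real.log X := by
    have h1 : (Q₀ : ℝ) ≤ y := by
      rw [hQ₀def]
      refine (Nat.floor_le (by positivity)).trans ?_
      calc y ^ ((1 : ℝ) / 3) ≤ y ^ (1 : ℝ) := Real.rpow_le_rpow_of_exponent_le hy1.le (by norm_num)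
        _ = y := Real.rpow_one y
    have hQ₀pos : (0 : ℝ) < Q₀ := by exact_mod_cast hQ₀1
    exact Real.log_le_log hQ₀pos (h1.trans hyX)
  have hU0 : 4 * R + 4 * S * Q₀ + Z * (1 + Real.log Q₀) ^ 2 ≤
      104 * (R + X ^ ((5 : ℝ) / 6)) * Real.log X ^ 3 :=
    majorant_arith hX1 hlogX1 hR0 hS hQ₀X (Real.log_natCast_nonneg Q₀) hlogQ₀
      (by rw [hZ]; linarith)
  ------------------------------------------------------------------
  -- Step 4: the lower bound `primeCountZ · log X ≥ y / 2`
  ------------------------------------------------------------------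
  have hPClow : y / 2 ≤ (primeCountZ l y : ℝ) * Real.log X := by
    have hg0 : Int.gcd (l.1 * 0 + l.2) ((l.1.natAbs * 1 : ℕ) : ℤ) = 1 :=
      int_gcd_formEval_eq_one hgcd (by simp)
    obtain ⟨u0, hu0eq⟩ : IsUnit (((formEval l 0 : ℤ)) : ZMod l.1.natAbs) :=
      isUnit_of_int_gcd_eq_one (by simpa only [formEval, mul_one, mul_zero, zero_add] using hg0)
    have hPC : primeCountZ l y =
        #((Icc Vl Vh).filter (fun p : ℕ => p.Prime ∧
          (p : ZMod l.1.natAbs) = (u0 : ZMod l.1.natAbs))) := by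
      rw [hu0eq, primeCountZ_eq_primeCountZMod_one l y 0]
      exact primeCountZMod_eq_card ha hne hpos 0 (by simp)
    have hDa := abs_card_sub_div_le ha0 u0 (hAprop _ ha0 u0) hA1 hSprop hV hVhX
    rw [hPC]
    set ca := (#((Icc Vl Vh).filter (fun p : ℕ => p.Prime ∧
          (p : ZMod l.1.natAbs) = (u0 : ZMod l.1.natAbs))) : ℝ)
    have hAa0 := hA0 l.1.natAbs
    -- (i) ca ≥ tot/φ(|a|) - 8 (R + S)
    have hca : tot / Nat.totient l.1.natAbs - 8 * (R + S) ≤ ca := by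
      have h2 : (A 1 + S) / Nat.totient l.1.natAbs ≤ A 1 + S := div_le_self (by positivity) hφa1
      have h3 := (abs_le.1 hDa).1
      linarith
    -- (ii) tot · log X ≥ |a| (n₂ - n₁) - 2 A 1 - S
    have htotlog := card_primes_Icc_mul_log_ge hX1 hA1 hSprop hV hVhX
    have hdiff : (Vh : ℝ) - Vl = (l.1.natAbs : ℝ) * ((⌊2 * y⌋ : ℝ) - ⌈y⌉) := by
      rw [hVhR, hVlR, hvhi, hvlo]
      have : ((max (formEval l ⌈y⌉) (formEval l ⌊2 * y⌋) : ℤ) : ℝ) -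
          ((min (formEval l ⌈y⌉) (formEval l ⌊2 * y⌋) : ℤ) : ℝ) =
          |((formEval l ⌈y⌉ : ℤ) : ℝ) - ((formEval l ⌊2 * y⌋ : ℤ) : ℝ)| := by
        rw [Int.cast_max, Int.cast_min, max_sub_min_eq_abs']
      rw [this]
      simp only [formEval, Int.cast_add, Int.cast_mul]
      rw [Nat.cast_natAbs, Int.cast_abs]
      have hnn : (0 : ℝ) ≤ ((⌊2 * y⌋ : ℤ) : ℝ) - ((⌈y⌉ : ℤ) : ℝ) := by
        have : ((⌈y⌉ : ℤ) : ℝ) ≤ ((⌊2 * y⌋ : ℤ) : ℝ) := by exact_mod_cast hne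
        linarith
      rw [show ((l.1 : ℤ) : ℝ) * ⌈y⌉ + l.2 - ((l.1 : ℝ) * ⌊2 * y⌋ + l.2) =
          -(((l.1 : ℤ) : ℝ) * (((⌊2 * y⌋ : ℤ) : ℝ) - ⌈y⌉)) by ring, abs_neg, abs_mul,
        abs_of_nonneg hnn]
    have hlen : y - 2 ≤ ((⌊2 * y⌋ : ℤ) : ℝ) - ((⌈y⌉ : ℤ) : ℝ) := by
      have h1 := Int.lt_floor_add_one (2 * y)
      have h2 := Int.ceil_lt_add_one y
      linarith
    have hlen0 : 0 ≤ ((⌊2 * y⌋ : ℤ) : ℝ) - ((⌈y⌉ : ℤ) : ℝ) := by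
      have : ((⌈y⌉ : ℤ) : ℝ) ≤ ((⌊2 * y⌋ : ℤ) : ℝ) := by exact_mod_cast hne
      linarith
    rw [hdiff] at htotlog
    exact lowerBound_arith hca htotlog hlen hlen0 hφa1 hφale htot0 hlogX0 hA1R hA10 hS0 hJ
  ------------------------------------------------------------------
  -- Step 5: conclusion
  ------------------------------------------------------------------
  have hPC0 : 0 ≤ (primeCountZ l y : ℝ) := Nat.cast_nonneg _
  have hlogy : 0 < Real.log y := Real.log_pos hy1
  have hlogyX : Real.log y ^ (100 * k ^ 2) ≤ Real.log X ^ (100 * k ^ 2) :=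
    pow_le_pow_left₀ hlogy.le (Real.log_le_log hy0 hyX) _
  have hLHS : ∑ q ∈ F₀,
      (if Int.gcd (formEval l (cq q)) q = 1 then
          |(primeCountZMod l y q (cq q) : ℝ) - primeCountZ l y / totForm l q| else 0) ≤
      104 * (R + X ^ ((5 : ℝ) / 6)) * Real.log X ^ 3 :=
    (Finset.sum_le_sum hterm).trans (hsumβ.trans hU0)
  refine hLHS.trans ?_
  rw [one_mul, le_div_iff₀ (pow_pos hlogy _)]
  -- U · (log y)^{100k²} ≤ U (log X)^{100k²} ≤ PC
  have hUnn : 0 ≤ 104 * (R + X ^ ((5 : ℝ) / 6)) * Real.log X ^ 3 := by positivity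
  refine (mul_le_mul_of_nonneg_left hlogyX hUnn).trans ?_
  -- multiply by log X
  refine le_of_mul_le_mul_right ?_ hlogX0
  calc 104 * (R + X ^ ((5 : ℝ) / 6)) * Real.log X ^ 3 * Real.log X ^ (100 * k ^ 2) * Real.log X
      = (2 * Real.log X * Real.log X ^ (100 * k ^ 2) *
          (104 * (R + X ^ ((5 : ℝ) / 6)) * Real.log X ^ 3)) / 2 := by ring
    _ ≤ y / 2 := by linarith
    _ ≤ (primeCountZ l y : ℝ) * Real.log X := hPClow

/-! ### Numerical inequalities at `X = 4 x log³ x` -/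

/-- Elementary inequalities for `X = 4 e^L L³`, `L ≥ 100`: `L ≤ log X ≤ 2L`, `√log X ≤ L`,
`e^L ≤ X`. [folklore] -/
private theorem numericsX {L X : ℝ} (hL : 100 ≤ L) (hX : X = 4 * Real.exp L * L ^ 3) :
    Real.log X ≤ 2 * L ∧ L ≤ Real.log X ∧ Real.sqrt (Real.log X) ≤ L ∧ Real.exp L ≤ X ∧
      1 ≤ X ∧ Real.log X = Real.log (4 * L ^ 3) + L ∧ 0 ≤ Real.log (4 * L ^ 3) := by
  have hL1 : 1 ≤ L := by linarith
  have hL0 : 0 < L := by linarith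
  set x := Real.exp L with hx
  have hx0 : 0 < x := Real.exp_pos L
  have hlogx : Real.log x = L := Real.log_exp L
  have hL3 : 1 ≤ L ^ 3 := one_le_pow₀ hL1
  have hxX : x ≤ X := by rw [hX]; nlinarith
  have hx1 : 1 ≤ x := by have := Real.add_one_le_exp L; rw [hx]; linarith
  have hX1 : 1 ≤ X := hx1.trans hxX
  have hlogX : Real.log X = Real.log (4 * L ^ 3) + L := by
    rw [hX, show 4 * x * L ^ 3 = (4 * L ^ 3) * x by ring,
      Real.log_mul (by positivity) hx0.ne', hlogx]
  have hlog4L3 : Real.log (4 * L ^ 3) = Real.log 4 + 3 * Real.log L := by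
    rw [Real.log_mul (by norm_num) (by positivity), Real.log_pow]; push_cast; ring
  have hlogL := log_le_div_twenty_add_two hL0
  have hlogL0 : 0 ≤ Real.log L := Real.log_nonneg hL1
  have hlog4 : Real.log 4 ≤ 2 := by
    have h4 : Real.log 4 = 2 * Real.log 2 := by
      rw [show (4 : ℝ) = 2 ^ 2 by norm_num, Real.log_pow]; push_cast; ring
    rw [h4]; have := Real.log_two_lt_d9; linarith
  have hlog4_0 : 0 ≤ Real.log 4 := Real.log_nonneg (by norm_num)
  have hlog4L3_0 : 0 ≤ Real.log (4 * L ^ 3) := by rw [hlog4L3]; positivity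
  have n1 : Real.log X ≤ 2 * L := by rw [hlogX, hlog4L3]; linarith
  have n2 : L ≤ Real.log X := by rw [hlogX]; linarith
  have n3 : Real.sqrt (Real.log X) ≤ L := by
    calc Real.sqrt (Real.log X) ≤ Real.sqrt (L ^ 2) := Real.sqrt_le_sqrt (by nlinarith)
      _ = L := by rw [Real.sqrt_sq hL0.le]
  exact ⟨n1, n2, n3, hxX, hX1, hlogX, hlog4L3_0⟩

set_option maxHeartbeats 800000 in
/-- The numerical side conditions of `hypothesisOneZ_of_majorant` at `X = 4 x log³ x`,
`x = e^L`, `L ≥ 100`, given `(100k²+9) log(2L) + log(1664(K+1)) ≤ (c₁/2)√L`: the level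
`|a| y^{1/3} ≤ X^{9/20}`, and `(log X)^{100k²+4} (R + X^{5/6}) ≪ y` with
`R = K X exp(-c₁ √log X)`. [cite: FordGreenKonyaginMaynardTao2018, §7 proof of Lemma 7.2] -/
private theorem numericsKY {L X c₁ K R S y : ℝ} {k : ℕ} (hL : 100 ≤ L)
    (hX : X = 4 * Real.exp L * L ^ 3) (hc₁ : 0 < c₁) (hc₁1 : c₁ ≤ 1) (hK : 0 < K)
    (hE : (100 * (k : ℝ) ^ 2 + 9) * Real.log (2 * L) + Real.log (1664 * (K + 1)) ≤
      c₁ / 2 * Real.sqrt L)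
    (hR : R = K * X * Real.exp (-(c₁ * Real.sqrt (Real.log X))))
    (hS : S = 2 * Real.sqrt X * Real.log X)
    (hy1 : Real.exp L / 2 ≤ y) (hy2 : y ≤ Real.exp L * L ^ 2) :
    L * y ^ ((1 : ℝ) / 3) ≤ X ^ ((9 : ℝ) / 20) ∧ y ≤ X ∧
      2 + 2 * R + S + 8 * (R + S) * Real.log X ≤ y / 2 ∧
      2 * Real.log X * Real.log X ^ (100 * k ^ 2) *
        (104 * (R + X ^ ((5 : ℝ) / 6)) * Real.log X ^ 3) ≤ y := by
  obtain ⟨n1, n2, -, hxX, hX1, hlogX, hlog4L3_0⟩ := numericsX hL hX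
  have hL1 : 1 ≤ L := by linarith
  have hL0 : 0 < L := by linarith
  set x := Real.exp L with hx
  have hx0 : 0 < x := Real.exp_pos L
  have hx101 : 101 ≤ x := by have := Real.add_one_le_exp L; rw [hx]; linarith
  have hlogx : Real.log x = L := Real.log_exp L
  have hX0 : 0 < X := by linarith
  have hlogX1 : 1 ≤ Real.log X := hL1.trans n2
  have hlogX0 : 0 < Real.log X := by linarith
  have hy0 : 0 < y := by linarith [half_pos hx0]
  have hlogL := log_le_div_twenty_add_two hL0
  have hlogL0 : 0 ≤ Real.log L := Real.log_nonneg hL1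
  ----------------------------------------------------------------
  -- (a) `L y^{1/3} ≤ X^{9/20}` and `y ≤ X`
  ----------------------------------------------------------------
  have na : L * y ^ ((1 : ℝ) / 3) ≤ X ^ ((9 : ℝ) / 20) := by
    have hxL2 : 0 < x * L ^ 2 := by positivity
    have e1 : y ^ ((1 : ℝ) / 3) ≤ (x * L ^ 2) ^ ((1 : ℝ) / 3) :=
      Real.rpow_le_rpow hy0.le hy2 (by norm_num)
    have e2 : (x * L ^ 2) ^ ((1 : ℝ) / 3) =
        Real.exp ((L + 2 * Real.log L) * ((1 : ℝ) / 3)) := by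
      rw [Real.rpow_def_of_pos hxL2, Real.log_mul hx0.ne' (by positivity), hlogx, Real.log_pow]
      push_cast; ring_nf
    have e3 : L = Real.exp (Real.log L) := (Real.exp_log hL0).symm
    have e4 : X ^ ((9 : ℝ) / 20) = Real.exp (Real.log X * ((9 : ℝ) / 20)) :=
      Real.rpow_def_of_pos hX0 _
    have e5 : Real.log L + (L + 2 * Real.log L) * ((1 : ℝ) / 3) ≤
        Real.log X * ((9 : ℝ) / 20) := by
      linarith
    calc L * y ^ ((1 : ℝ) / 3) ≤ L * (x * L ^ 2) ^ ((1 : ℝ) / 3) :=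
          mul_le_mul_of_nonneg_left e1 hL0.le
      _ = Real.exp (Real.log L + (L + 2 * Real.log L) * ((1 : ℝ) / 3)) := by
          rw [e2, Real.exp_add, ← e3]
      _ ≤ Real.exp (Real.log X * ((9 : ℝ) / 20)) := Real.exp_le_exp.2 e5
      _ = X ^ ((9 : ℝ) / 20) := e4.symm
  have nb : y ≤ X := by
    rw [hX]; refine hy2.trans ?_
    have h1 : L ^ 2 ≤ L ^ 3 := pow_le_pow_right₀ hL1 (by norm_num)
    have h2 := mul_le_mul_of_nonneg_left h1 hx0.le
    have h3 : 0 ≤ x * L ^ 3 := by positivity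
    linarith
  ----------------------------------------------------------------
  -- (b) the factor `G = (2L)^{100k²+9}` and the products `R·G`, `X^{5/6}·G`
  ----------------------------------------------------------------
  set E₀ := (100 * (k : ℝ) ^ 2 + 9) * Real.log (2 * L) with hE₀
  set C₀ := Real.log (1664 * (K + 1)) with hC₀
  set G := Real.exp E₀ with hG
  have h2L : 1 ≤ 2 * L := by linarith
  have hlog2L0 : 0 ≤ Real.log (2 * L) := Real.log_nonneg h2L
  have hGpow : G = (2 * L) ^ (100 * k ^ 2 + 9) := by
    rw [hG, hE₀, show (100 * (k : ℝ) ^ 2 + 9) = ((100 * k ^ 2 + 9 : ℕ) : ℝ) by push_cast; ring,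
      Real.exp_nat_mul, Real.exp_log (by linarith)]
  have g1 : Real.log X ^ (100 * k ^ 2 + 9) ≤ G := by
    rw [hGpow]; exact pow_le_pow_left₀ hlogX0.le n1 _
  have g1' : ∀ j : ℕ, j ≤ 100 * k ^ 2 + 9 → Real.log X ^ j ≤ G := fun j hj =>
    (pow_le_pow_right₀ hlogX1 hj).trans g1
  have g2 : L ^ 3 ≤ G := by
    rw [hGpow]
    calc L ^ 3 ≤ (2 * L) ^ 3 := pow_le_pow_left₀ hL0.le (by linarith) 3
      _ ≤ (2 * L) ^ (100 * k ^ 2 + 9) := pow_le_pow_right₀ h2L (by omega)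
  have hG0 : 0 < G := Real.exp_pos _
  have hG1 : 1 ≤ G := le_trans (one_le_pow₀ hL1) g2
  set T := Real.exp (c₁ * Real.sqrt L) with hT
  have hT0 : 0 < T := Real.exp_pos _
  have hexpC₀ : Real.exp C₀ = 1664 * (K + 1) := by rw [hC₀, Real.exp_log (by positivity)]
  set e₂ := Real.exp (2 * C₀) with he₂
  have he₂val : e₂ = (1664 * (K + 1)) ^ 2 := by
    rw [he₂, show 2 * C₀ = ((2 : ℕ) : ℝ) * C₀ by norm_num, Real.exp_nat_mul, hexpC₀]
  have he₂0 : 0 < e₂ := Real.exp_pos _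
  have hsqrtL6 : 6 ≤ Real.sqrt L := by
    rw [show (6 : ℝ) = Real.sqrt (6 ^ 2) by rw [Real.sqrt_sq (by norm_num)]]
    exact Real.sqrt_le_sqrt (by norm_num; linarith)
  have hsqrtL : Real.sqrt L * Real.sqrt L = L := Real.mul_self_sqrt hL0.le
  have hc₁sqrt : c₁ * Real.sqrt L ≤ L / 6 := by
    have h1 : c₁ * Real.sqrt L ≤ Real.sqrt L := mul_le_of_le_one_left (Real.sqrt_nonneg _) hc₁1
    have h2 : 6 * Real.sqrt L ≤ Real.sqrt L * Real.sqrt L :=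
      mul_le_mul_of_nonneg_right hsqrtL6 (Real.sqrt_nonneg _)
    linarith
  have g3 : G ^ 2 * e₂ ≤ T := by
    rw [hG, he₂, hT, ← Real.exp_nat_mul, ← Real.exp_add]; push_cast
    exact Real.exp_le_exp.2 (by linarith)
  have g3' : G ^ 2 ≤ T / e₂ := by rw [le_div_iff₀ he₂0]; exact g3
  have hTL : T ≤ Real.exp (L / 6) := Real.exp_le_exp.2 hc₁sqrt
  -- `R ≤ 4 K x L³ / T`
  have hR0 : 0 ≤ R := by rw [hR]; positivity
  have hRle : R ≤ 4 * K * x * L ^ 3 * T⁻¹ := by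
    have h1 : Real.exp (-(c₁ * Real.sqrt (Real.log X))) ≤ T⁻¹ := by
      rw [hT, ← Real.exp_neg, Real.exp_le_exp, neg_le_neg_iff]
      exact mul_le_mul_of_nonneg_left (Real.sqrt_le_sqrt n2) hc₁.le
    rw [hR]
    calc K * X * Real.exp (-(c₁ * Real.sqrt (Real.log X))) ≤ K * X * T⁻¹ :=
          mul_le_mul_of_nonneg_left h1 (by positivity)
      _ = 4 * K * x * L ^ 3 * T⁻¹ := by rw [hX]; ring
  -- (P1) `R G ≤ 4 K x / e₂`
  have s3 : G ^ 2 * T⁻¹ ≤ e₂⁻¹ := by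
    calc G ^ 2 * T⁻¹ ≤ T / e₂ * T⁻¹ := mul_le_mul_of_nonneg_right g3' (inv_nonneg.2 hT0.le)
      _ = e₂⁻¹ := by field_simp
  have sLG : L ^ 3 * G ≤ G ^ 2 := by
    rw [pow_two]; exact mul_le_mul_of_nonneg_right g2 hG0.le
  have P1 : R * G ≤ 4 * K * x * e₂⁻¹ := by
    have s2 : L ^ 3 * G ≤ G ^ 2 := sLG
    calc R * G ≤ 4 * K * x * L ^ 3 * T⁻¹ * G := mul_le_mul_of_nonneg_right hRle hG0.le
      _ = 4 * K * x * T⁻¹ * (L ^ 3 * G) := by ring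
      _ ≤ 4 * K * x * T⁻¹ * G ^ 2 := mul_le_mul_of_nonneg_left s2 (by positivity)
      _ = 4 * K * x * (G ^ 2 * T⁻¹) := by ring
      _ ≤ 4 * K * x * e₂⁻¹ := mul_le_mul_of_nonneg_left s3 (by positivity)
  -- (P2) `X^{5/6} G ≤ 4 x / e₂`
  set P := X ^ ((5 : ℝ) / 6) with hP
  have hP0 : 0 ≤ P := by positivity
  have hPle : P ≤ 4 * L ^ 3 * Real.exp (5 * L / 6) := by
    have h4L3 : (0 : ℝ) < 4 * L ^ 3 := by positivity
    rw [hP, Real.rpow_def_of_pos hX0, hlogX]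
    calc Real.exp ((Real.log (4 * L ^ 3) + L) * ((5 : ℝ) / 6))
        ≤ Real.exp (Real.log (4 * L ^ 3) + 5 * L / 6) := Real.exp_le_exp.2 (by linarith)
      _ = 4 * L ^ 3 * Real.exp (5 * L / 6) := by rw [Real.exp_add, Real.exp_log h4L3]
  have P2 : P * G ≤ 4 * x * e₂⁻¹ := by
    have s2 : L ^ 3 * G ≤ G ^ 2 := sLG
    have s4 : G ^ 2 ≤ Real.exp (L / 6) * e₂⁻¹ := by
      calc G ^ 2 ≤ T / e₂ := g3'
        _ ≤ Real.exp (L / 6) / e₂ := div_le_div_of_nonneg_right hTL he₂0.le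
        _ = Real.exp (L / 6) * e₂⁻¹ := div_eq_mul_inv _ _
    have hexpL : Real.exp (L / 6) * Real.exp (5 * L / 6) = x := by
      rw [← Real.exp_add, hx]; ring_nf
    calc P * G ≤ 4 * L ^ 3 * Real.exp (5 * L / 6) * G := mul_le_mul_of_nonneg_right hPle hG0.le
      _ = 4 * Real.exp (5 * L / 6) * (L ^ 3 * G) := by ring
      _ ≤ 4 * Real.exp (5 * L / 6) * G ^ 2 := mul_le_mul_of_nonneg_left s2 (by positivity)
      _ ≤ 4 * Real.exp (5 * L / 6) * (Real.exp (L / 6) * e₂⁻¹) :=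
          mul_le_mul_of_nonneg_left s4 (by positivity)
      _ = 4 * (Real.exp (L / 6) * Real.exp (5 * L / 6)) * e₂⁻¹ := by ring
      _ = 4 * x * e₂⁻¹ := by rw [hexpL]
  -- the main product bound `(R + P) G ≤ x / 100000`
  have hprod : (R + P) * G ≤ x / 100000 := by
    have hK1 : 1 ≤ K + 1 := by linarith
    have s5 : (R + P) * G ≤ 4 * (K + 1) * x * e₂⁻¹ := by
      have : (R + P) * G = R * G + P * G := by ring
      have : 4 * (K + 1) * x * e₂⁻¹ = 4 * K * x * e₂⁻¹ + 4 * x * e₂⁻¹ := by ring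
      linarith
    have s6 : 4 * (K + 1) * x * e₂⁻¹ = x * (4 * (K + 1) / (1664 * (K + 1)) ^ 2) := by
      rw [he₂val]; ring
    have s7 : 4 * (K + 1) / (1664 * (K + 1)) ^ 2 ≤ 1 / 100000 := by
      rw [div_le_div_iff₀ (by positivity) (by norm_num)]
      have h1 : K + 1 ≤ (K + 1) ^ 2 := by
        rw [pow_two]; exact le_mul_of_one_le_left (by linarith) hK1
      have h2 : 1 * (1664 * (K + 1)) ^ 2 = 2768896 * (K + 1) ^ 2 := by ring
      rw [h2]
      linarith
    calc (R + P) * G ≤ x * (4 * (K + 1) / (1664 * (K + 1)) ^ 2) := by rw [← s6]; exact s5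
      _ ≤ x * (1 / 100000) := mul_le_mul_of_nonneg_left s7 hx0.le
      _ = x / 100000 := by ring
  ----------------------------------------------------------------
  -- (c) `hU` and (d) `hJ`
  ----------------------------------------------------------------
  have nc : 2 * Real.log X * Real.log X ^ (100 * k ^ 2) *
      (104 * (R + P) * Real.log X ^ 3) ≤ y := by
    have s1 : 2 * Real.log X * Real.log X ^ (100 * k ^ 2) * (104 * (R + P) * Real.log X ^ 3) =
        208 * (R + P) * Real.log X ^ (100 * k ^ 2 + 4) := by ring
    rw [s1]
    have s2 := g1' (100 * k ^ 2 + 4) (by omega)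
    have s3 : 208 * (R + P) * Real.log X ^ (100 * k ^ 2 + 4) ≤ 208 * ((R + P) * G) := by
      have := mul_le_mul_of_nonneg_left s2 (by positivity : (0 : ℝ) ≤ 208 * (R + P))
      linarith
    linarith
  have nd : 2 + 2 * R + S + 8 * (R + S) * Real.log X ≤ y / 2 := by
    have hsqrtX' : Real.sqrt X ≤ P := by
      rw [hP, Real.sqrt_eq_rpow]; exact Real.rpow_le_rpow_of_exponent_le hX1 (by norm_num)
    have hS0 : 0 ≤ S := by rw [hS]; positivity
    have hSle : S ≤ 2 * P * Real.log X := by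
      rw [hS]; exact mul_le_mul_of_nonneg_right (by linarith) hlogX0.le
    have hl1 := g1' 1 (by omega)
    have hl2 := g1' 2 (by omega)
    rw [pow_one] at hl1
    have t1 : R ≤ R * G := le_mul_of_one_le_right hR0 hG1
    have t2 : S ≤ 2 * P * G := hSle.trans (mul_le_mul_of_nonneg_left hl1 (by positivity))
    have t3 : R * Real.log X ≤ R * G := mul_le_mul_of_nonneg_left hl1 hR0
    have t4 : S * Real.log X ≤ 2 * P * G := by
      calc S * Real.log X ≤ 2 * P * Real.log X * Real.log X :=
            mul_le_mul_of_nonneg_right hSle hlogX0.le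
        _ = 2 * P * Real.log X ^ 2 := by ring
        _ ≤ 2 * P * G := mul_le_mul_of_nonneg_left hl2 (by positivity)
    have t5 : 2 + 2 * R + S + 8 * (R + S) * Real.log X ≤ 2 + 18 * ((R + P) * G) := by
      have r1 : 8 * (R + S) * Real.log X = 8 * (R * Real.log X) + 8 * (S * Real.log X) := by ring
      have r2 : (R + P) * G = R * G + P * G := by ring
      have r3 : 0 ≤ R * G := by positivity
      rw [r1, r2]
      linarith
    linarith
  exact ⟨na, nb, nd, nc⟩

end FGKMT2018

open FGKMT2018 in
/-- **[FordGreenKonyaginMaynardTao2018, Lemma 7.2]** (with the primitivity hypothesis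
`gcd(a, b) = 1`, see the ERRATUM note on the statement): there is `C_H > 0` (here `C_H = 1`) such
that for all large `x` there is `B ∈ {1} ∪ primes`, `B ≤ x`, for which every non-degenerate
primitive form `a n + b` with `|a| ≤ log x`, `|b| ≤ x log² x`, `(a, B) = 1`, non-negative on
`(y, 2y]` (`x/2 ≤ y ≤ x log² x`), satisfies Hypothesis 1 of the multidimensional sieve at
`θ = 1/3` for every `k ≤ (log x)^{1/5}`.  Proof: Landau–Page + Bombieri–Vinogradov with the
exceptional character removed (`bombieriVinogradov_coprime`, display (7.5)) and partial summation.
[cite: FordGreenKonyaginMaynardTao2018, Lemma 7.2 p. 20, proof pp. 21–22 ((7.4), (7.5))] -/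
theorem fordGreenKonyaginMaynardTao2018_lemma72_holds :
    FordGreenKonyaginMaynardTao2018_lemma72 := by
  obtain ⟨c, hc, K, hK, hBV⟩ := bombieriVinogradov_coprime
  set c₁ := min c 1 with hc₁def
  have hc₁ : 0 < c₁ := lt_min hc one_pos
  have hc₁1 : c₁ ≤ 1 := min_le_right _ _
  have hc₁c : c₁ ≤ c := min_le_left _ _
  -- weaken the saving to `c₁ ≤ 1`
  have hBV₁ : ∀ᶠ X : ℝ in atTop, ∃ B : ℕ, (B = 1 ∨ B.Prime) ∧
      (B : ℝ) ≤ Real.exp (Real.sqrt (Real.log X)) ∧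
      ∀ Q : ℕ, (Q : ℝ) ≤ X ^ (9 / 20 : ℝ) → ∀ y : ℕ → ℝ, (∀ q, 0 ≤ y q ∧ y q ≤ X) →
        ∑ q ∈ (Icc 1 Q).filter (fun q => Nat.Coprime q B),
            ⨆ a : (ZMod q)ˣ, |ParityWave0.chebyshevPsiMod q a (y q) - y q / Nat.totient q| ≤
          K * X * Real.exp (-(c₁ * Real.sqrt (Real.log X))) := by
    filter_upwards [hBV, eventually_ge_atTop 0] with X hX hX0
    obtain ⟨B, hB, hBle, h⟩ := hX
    refine ⟨B, hB, hBle, fun Q hQ y hy => (h Q hQ y hy).trans ?_⟩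
    refine mul_le_mul_of_nonneg_left (Real.exp_le_exp.2 ?_) (by positivity)
    exact neg_le_neg (mul_le_mul_of_nonneg_right hc₁c (Real.sqrt_nonneg _))
  have hMax := bvMax_of_bv hBV₁
  -- pull back along `X(x) = 4 x log³ x`
  have hlogT : Tendsto (fun x : ℕ => Real.log (x : ℝ)) atTop atTop :=
    Real.tendsto_log_atTop.comp tendsto_natCast_atTop_atTop
  have hXT : Tendsto (fun x : ℕ => 4 * (x : ℝ) * Real.log x ^ 3) atTop atTop := by
    refine tendsto_atTop_mono' atTop ?_ tendsto_natCast_atTop_atTop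
    filter_upwards [hlogT.eventually (eventually_ge_atTop 1)] with x hx
    have h3 : (1 : ℝ) ≤ Real.log x ^ 3 := one_le_pow₀ hx
    have hx0 : (0 : ℝ) ≤ x := Nat.cast_nonneg x
    have := mul_le_mul_of_nonneg_left h3 hx0
    linarith
  refine ⟨1, one_pos, ?_⟩
  filter_upwards [hXT.eventually hMax, eventually_klog_le (Real.log (1664 * (K + 1))) hc₁,
    hlogT.eventually (eventually_ge_atTop 100)] with x hA hklog hL
  set L := Real.log (x : ℝ) with hLdef
  set X := 4 * (x : ℝ) * L ^ 3 with hXdef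
  obtain ⟨B, hB, hBle, hAQ⟩ := hA
  have hx1 : (1 : ℝ) < x := by
    by_contra h
    have := Real.log_nonpos (Nat.cast_nonneg x) (not_lt.1 h)
    linarith
  have hx0 : (0 : ℝ) < x := by linarith
  have hxexp : (x : ℝ) = Real.exp L := by rw [hLdef, Real.exp_log hx0]
  have hXeq : X = 4 * Real.exp L * L ^ 3 := by rw [hXdef, hxexp]
  obtain ⟨n1, n2, n3, hxX, hX1, -, -⟩ := numericsX hL hXeq
  have hL1 : 1 ≤ L := by linarith
  refine ⟨B, hB, ?_, ?_⟩
  · have : (B : ℝ) ≤ x := hBle.trans (by rw [hxexp]; exact Real.exp_le_exp.2 n3)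
    exact_mod_cast this
  · intro k l y hk ha hgcd hla hlb hy1 hy2 hpos hcop
    have hE := hklog k hk
    set Q := ⌊X ^ ((9 : ℝ) / 20)⌋₊ with hQdef
    obtain ⟨A, hA0, hAprop, hAsum⟩ := hAQ Q (Nat.floor_le (by positivity))
    set R := K * X * Real.exp (-(c₁ * Real.sqrt (Real.log X))) with hRdef
    set S := 2 * Real.sqrt X * Real.log X with hSdef
    have hy1e : Real.exp L / 2 ≤ y := by rw [← hxexp]; exact hy1
    have hy2e : y ≤ Real.exp L * L ^ 2 := by rw [← hxexp]; exact hy2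
    obtain ⟨n5, n6, hJ, hU⟩ := numericsKY hL hXeq hc₁ hc₁1 hK hE hRdef hSdef hy1e hy2e
    have hy0 : 0 < y := by linarith
    have hy1' : 1 < y := by
      have : (101 : ℝ) ≤ x := by
        have := Real.add_one_le_exp L; rw [hxexp]; linarith
      linarith
    -- the values of the form on the block lie in `[0, X]`
    have hla' : ((l.1.natAbs : ℕ) : ℝ) ≤ L := by rw [Nat.cast_natAbs, Int.cast_abs]; exact hla
    have hvals : ∀ n ∈ dyadZ y, ((formEval l n : ℤ) : ℝ) ≤ X := by
      intro n hn
      rw [dyadZ, Finset.mem_Icc] at hn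
      have hn1 : y ≤ (n : ℝ) := Int.ceil_le.1 hn.1
      have hn2 : ((n : ℤ) : ℝ) ≤ 2 * y := Int.le_floor.1 hn.2
      have hn0 : (0 : ℝ) ≤ n := hy0.le.trans hn1
      simp only [formEval, Int.cast_add, Int.cast_mul]
      have e1 : ((l.1 : ℤ) : ℝ) * n ≤ L * (2 * y) := by
        calc ((l.1 : ℤ) : ℝ) * n ≤ |((l.1 : ℤ) : ℝ)| * n :=
              mul_le_mul_of_nonneg_right (le_abs_self _) hn0
          _ ≤ L * (2 * y) := mul_le_mul hla hn2 hn0 (by linarith)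
      have e2 : ((l.2 : ℤ) : ℝ) ≤ x * L ^ 2 := (le_abs_self _).trans hlb
      have e3 : L * (2 * y) ≤ 2 * (x * L ^ 2) * L := by
        have := mul_le_mul_of_nonneg_left hy2 (show (0 : ℝ) ≤ 2 * L by positivity)
        linarith
      have e4 : (x : ℝ) * L ^ 2 ≤ x * L ^ 3 :=
        mul_le_mul_of_nonneg_left (pow_le_pow_right₀ hL1 (by norm_num)) hx0.le
      rw [hXdef]
      linarith
    have haQ : l.1.natAbs * ⌊y ^ ((1 : ℝ) / 3)⌋₊ ≤ Q := by
      rw [hQdef]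
      refine Nat.le_floor ?_
      push_cast
      calc ((l.1.natAbs : ℕ) : ℝ) * (⌊y ^ ((1 : ℝ) / 3)⌋₊ : ℝ) ≤ L * y ^ ((1 : ℝ) / 3) :=
            mul_le_mul hla' (Nat.floor_le (by positivity)) (Nat.cast_nonneg _) (by linarith)
        _ ≤ X ^ ((9 : ℝ) / 20) := n5
    exact hypothesisOneZ_of_majorant hX1 (hL1.trans n2) hA0 hAprop hAsum hSdef ha hgcd hcop
      hy1' n6 hpos hvals haQ hJ hU

/-- **`FordGreenKonyaginMaynardTao2018_lemma72` holds** — Ford–Green–Konyagin–Maynard–Tao 2018, Lemma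
7.2 (Hypothesis 1 at `θ = 1/3` off one exceptional modulus, `C_H = 1`): the exact-name `_holds`
alias of `fordGreenKonyaginMaynardTao2018_lemma72_holds` above (appended 2026-08-29, flt-inv gen 69;
D-0026 bookkeeping: the proof term is the existing theorem of this file; no statement, definition or
attribute is edited; no new named fact; the ledger's debt table listed the fact unproved at +60 min,
`ledger fact claim` GRANTED 2026-08-29T06:24Z).
[cite: FordGreenKonyaginMaynardTao2018, Lemma 7.2 p. 20, proof pp. 21–22 ((7.4), (7.5))] -/
theorem FordGreenKonyaginMaynardTao2018_lemma72_holds :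
    _root_.Literature.NumberTheory.Sieve.FordGreenKonyaginMaynardTao2018_lemma72 :=
  _root_.Literature.NumberTheory.Sieve.fordGreenKonyaginMaynardTao2018_lemma72_holds

end Literature.NumberTheory.Sieve
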